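import Literature.Computability.Complexity.CircuitComposition
import Literature.Computability.Complexity.NegationElimination
import HarnessLib

/-!
# Simulating `B₂`-circuits over the De Morgan basis `{∧₂, ∨₂, ¬}`

The tree's uniform-to-nonuniform simulation (`P ⊆ P/poly`, `P_subset_PPoly_holds`) and its
arithmetic circuit library produce straight-line programs over the full binary basis `B₂`
(`Literature.Computability.Complexity.B2`, all gates of fan-in `≤ 2`, including the two
constants and `⊕`), while the monotone-complexity statements of the tree
(`Literature.Barriers.PneNP.MonotoneGap`, `Tardos1988_cliqueLike_polysize`, Amano–Maruoka, …)
speak about circuits over the De Morgan basis `deMorganBasis = {∧₂, ∨₂, ¬}` (Jukna 2012, §1.2).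
This file PROVES the standard constant-factor simulation between the two (Jukna 2012, §1.2:
"circuits over any finite complete basis … can simulate each other with constant slowdown";
Vollmer 1999, §1.2; Wegener 1987, §1.4): every `B₂`-program with `s` gates on a nonempty set of
variables is simulated by a `{∧₂, ∨₂, ¬}`-program with at most `12 s + 3` gates
(`CktSize.deMorgan_of_B2`), and likewise for single-output circuits
(`Circuit.exists_deMorgan_of_B2`).

Construction: the two constants are produced once as `x₀ ∨ ¬x₀`, `x₀ ∧ ¬x₀` (three gates; this is
where a variable `x₀` is needed — `deMorganBasis` has no constant gates); then every `B₂`-gate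
`g(a, b)` (arity padded to `2`) is replaced by the multiplexer formula
`(a ∧ ((b ∧ g₁₁) ∨ (¬b ∧ g₁₀))) ∨ (¬a ∧ ((b ∧ g₀₁) ∨ (¬b ∧ g₀₀)))` reading its truth table
`gᵤᵥ` off the two constant wires (`12` gates as a formula). The bookkeeping is done in the
`CktSize` calculus of `CircuitComposition.lean` (no new gate-list surgery): `DMF`, a small type
of De Morgan formulas with `DMF.cktSize` (a formula with `m` connectives costs `m` gates), and
`cktSize_wiresFn`, the simulation of ALL wires of a `B₂`-program by induction on the program.

## References

* S. Jukna, *Boolean Function Complexity* (2012), §1.2 (bases, De Morgan circuits, constant-factor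
  simulations) [Jukna2012].
* H. Vollmer, *Introduction to Circuit Complexity* (1999), §1.2 [Vollmer1999].
-/

namespace Literature.Computability.Complexity

open GateList

variable {ι κ : Type*}

/-! ### De Morgan formulas and their programs -/

/-- De Morgan formulas over variables `J`: variables, negation, binary conjunction and
disjunction (Jukna 2012, §1.2, "DeMorgan formulas"). [cite: Jukna2012, §1.2] -/
inductive DMF (J : Type*) : Type _
  /-- a variable -/
  | var : J → DMF J
  /-- negation -/
  | neg : DMF J → DMF J
  /-- conjunction -/
  | conj : DMF J → DMF J → DMF J
  /-- disjunction -/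
  | disj : DMF J → DMF J → DMF J

namespace DMF

variable {J : Type*}

/-- The Boolean function of a De Morgan formula. [cite: Jukna2012, §1.2] -/
def eval : DMF J → (J → Bool) → Bool
  | var j, y => y j
  | neg φ, y => !(φ.eval y)
  | conj φ ψ, y => φ.eval y && ψ.eval y
  | disj φ ψ, y => φ.eval y || ψ.eval y

/-- The number of connectives (gates) of a De Morgan formula. [cite: Jukna2012, §1.2] -/
def size : DMF J → ℕ
  | var _ => 0
  | neg φ => φ.size + 1
  | conj φ ψ => φ.size + ψ.size + 1
  | disj φ ψ => φ.size + ψ.size + 1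

/-- **A De Morgan formula with `m` connectives is computed by a `{∧₂, ∨₂, ¬}`-program with
`m` gates** (the formula itself, as a straight-line program; Jukna 2012, §1.2).
[cite: Jukna2012, §1.2] -/
theorem cktSize : ∀ φ : DMF J,
    CktSize deMorganBasis (fun (y : J → Bool) (_ : Unit) => φ.eval y) φ.size
  | var j => (CktSize.proj deMorganBasis fun _ : Unit => j).congr fun _ _ => rfl
  | neg φ => by
    have h := (cktSize φ).comp
      (CktSize.gate (ι := Unit) (B := deMorganBasis) GateFn.not (by simp [deMorganBasis]) fun _ => ())
    exact h.congr fun y _ => by simp [GateFn.not, eval]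
  | conj φ ψ => by
    have h := ((cktSize φ).pair (cktSize ψ)).comp
      (CktSize.gate (ι := Unit ⊕ Unit) (B := deMorganBasis) (GateFn.and 2)
        (monotoneBasis_subset_deMorgan and_mem_monotoneBasis)
        ![Sum.inl (), Sum.inr ()])
    refine h.congr fun y _ => ?_
    simp only [GateFn.and, Fin.forall_fin_two, Matrix.cons_val_zero, Matrix.cons_val_one,
      Sum.elim_inl, Sum.elim_inr, Bool.decide_and, Bool.decide_eq_true, eval]
  | disj φ ψ => by
    have h := ((cktSize φ).pair (cktSize ψ)).comp
      (CktSize.gate (ι := Unit ⊕ Unit) (B := deMorganBasis) (GateFn.or 2)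
        (monotoneBasis_subset_deMorgan or_mem_monotoneBasis)
        ![Sum.inl (), Sum.inr ()])
    refine h.congr fun y _ => ?_
    simp only [GateFn.or, Fin.exists_fin_two, Matrix.cons_val_zero, Matrix.cons_val_one,
      Sum.elim_inl, Sum.elim_inr, Bool.decide_or, Bool.decide_eq_true, eval]

/-- The constant-true formula `x ∨ ¬x` on a variable `j`. [folklore] -/
def tt (j : J) : DMF J := disj (var j) (neg (var j))

/-- The constant-false formula `x ∧ ¬x` on a variable `j`. [folklore] -/
def ff (j : J) : DMF J := conj (var j) (neg (var j))

/-- `x ∨ ¬x = 1`. [folklore] -/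
@[simp] theorem eval_tt (j : J) (y : J → Bool) : (tt j).eval y = true := by
  cases h : y j <;> simp [tt, eval, h]

/-- `x ∧ ¬x = 0`. [folklore] -/
@[simp] theorem eval_ff (j : J) (y : J → Bool) : (ff j).eval y = false := by
  cases h : y j <;> simp [ff, eval, h]

/-- The **multiplexer formula** of a binary truth table `t`, reading the table entries off the
wires `c true`, `c false` (meant to carry the constants):
`(a ∧ ((b ∧ c t₁₁) ∨ (¬b ∧ c t₁₀))) ∨ (¬a ∧ ((b ∧ c t₀₁) ∨ (¬b ∧ c t₀₀)))`. [folklore] -/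
def mux (a b : J) (c : Bool → J) (t : Bool → Bool → Bool) : DMF J :=
  disj (conj (var a) (disj (conj (var b) (var (c (t true true))))
                           (conj (neg (var b)) (var (c (t true false))))))
       (conj (neg (var a)) (disj (conj (var b) (var (c (t false true))))
                                 (conj (neg (var b)) (var (c (t false false))))))

/-- The multiplexer formula has `12` connectives. [folklore] -/
@[simp] theorem size_mux (a b : J) (c : Bool → J) (t : Bool → Bool → Bool) :
    (mux a b c t).size = 12 := rfl

/-- If the wires `c v` carry the constants `v`, the multiplexer formula computes `t (y a) (y b)`.
[folklore] -/
theorem eval_mux (a b : J) (c : Bool → J) (t : Bool → Bool → Bool) (y : J → Bool)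
    (hc : ∀ v, y (c v) = v) : (mux a b c t).eval y = t (y a) (y b) := by
  simp only [mux, eval, hc]
  cases y a <;> cases y b <;> cases t true true <;> cases t true false <;>
    cases t false true <;> cases t false false <;> rfl

end DMF

/-! ### Simulating all wires of a `B₂`-program -/

/-- All wire values of a gate list `gs` on input `x` (input wires `inl i ↦ x i`, gate wires
`inr m ↦` value of gate `m`, junk `false` beyond the program), together with two constant
coordinates `inr v ↦ v`. [folklore] -/
def wiresFn (gs : List (Gate ι)) (x : ι → Bool) : (ι ⊕ ℕ) ⊕ Bool → Bool :=
  Sum.elim (wireOf x (vals gs x)) fun v => v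

/-- A gate of `B₂` has arity at most `2`. [folklore] -/
theorem arity_le_two_of_mem_B2 {g : Gate ι} (hg : g.fn ∈ B2) : g.arity ≤ 2 := hg

/-- The truth table of a gate of arity `≤ 2`, padded to arity `2`. [folklore] -/
def Gate.table (g : Gate ι) (hg : g.arity ≤ 2) (u v : Bool) : Bool :=
  g.op fun a => (![u, v] : Fin 2 → Bool) (Fin.castLE hg a)

/-- The argument wires of a gate of arity `≤ 2`, padded to two wires (the padding wire `w₀` is
arbitrary). [folklore] -/
def Gate.args₂ (g : Gate ι) (w₀ : ι ⊕ ℕ) (j : Fin 2) : ι ⊕ ℕ :=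
  if h : (j : ℕ) < g.arity then g.args ⟨j, h⟩ else w₀

/-- Reading the padded table at the padded arguments evaluates the gate. [folklore] -/
theorem Gate.table_args₂ (g : Gate ι) (hg : g.arity ≤ 2) (w₀ : ι ⊕ ℕ) (val : ι ⊕ ℕ → Bool) :
    g.table hg (val (g.args₂ w₀ 0)) (val (g.args₂ w₀ 1)) = g.op fun a => val (g.args a) := by
  unfold Gate.table
  congr 1
  funext a
  have ha : (a : ℕ) < g.arity := a.isLt
  have hcast : (Fin.castLE hg a : ℕ) = a := rfl
  have hargs : g.args₂ w₀ (Fin.castLE hg a) = g.args a := by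
    unfold Gate.args₂
    rw [dif_pos (by rw [hcast]; exact ha)]
    exact congrArg g.args (Fin.ext rfl)
  rw [← hargs]
  have key : ∀ j : Fin 2, (![val (g.args₂ w₀ 0), val (g.args₂ w₀ 1)] : Fin 2 → Bool) j =
      val (g.args₂ w₀ j) := Fin.forall_fin_two.2 ⟨rfl, rfl⟩
  exact key _

/-- Output routing of the base case: input wires to the inputs, gate wires (all junk) to the
constant `0`, the two constant coordinates to `x₀ ∨ ¬x₀` and `x₀ ∧ ¬x₀`. [folklore] -/
def baseRoute (ι : Type*) : (ι ⊕ ℕ) ⊕ Bool → (ι ⊕ Unit) ⊕ (Unit ⊕ Unit)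
  | .inl (.inl i) => .inl (.inl i)
  | .inl (.inr _) => .inr (.inr ())
  | .inr true => .inr (.inl ())
  | .inr false => .inr (.inr ())

/-- Output routing of the induction step: the new gate wire `inr L` to the block output,
everything else unchanged. [folklore] -/
def stepRoute (ι : Type*) (L : ℕ) : (ι ⊕ ℕ) ⊕ Bool → ((ι ⊕ ℕ) ⊕ Bool) ⊕ Unit
  | .inl (.inr m) => if m = L then .inr () else .inl (.inl (.inr m))
  | .inl (.inl i) => .inl (.inl (.inl i))
  | .inr v => .inl (.inr v)

/-- **All wires of a `B₂`-program with `s` gates are computed by a `{∧₂, ∨₂, ¬}`-program with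
`12 s + 3` gates** (given one input variable `i₀` to manufacture the constants): the constants
`x_{i₀} ∨ ¬x_{i₀}`, `x_{i₀} ∧ ¬x_{i₀}` once, then one multiplexer formula per gate
(Jukna 2012, §1.2; Vollmer 1999, §1.2). [cite: Jukna2012, §1.2] -/
theorem cktSize_wiresFn (i₀ : ι) : ∀ (gs : List (Gate ι)), (∀ g ∈ gs, g.fn ∈ B2) →
    CktSize deMorganBasis (wiresFn gs) (12 * gs.length + 3) := by
  intro gs
  induction gs using List.reverseRecOn with
  | nil =>
    intro _
    -- inputs for free, `¬x₀` shared by the two constants: 3 gates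
    have h1 : CktSize deMorganBasis (fun (x : ι → Bool) => Sum.elim x fun _ : Unit => !x i₀) 1 := by
      have h := (CktSize.id deMorganBasis).pair
        (CktSize.gate (ι := ι) (B := deMorganBasis) GateFn.not (by simp [deMorganBasis]) fun _ => i₀)
      exact (h.of_le (by simp)).congr fun x k => by rcases k with i | u <;> simp [GateFn.not]
    have h2 : CktSize deMorganBasis (fun (y : ι ⊕ Unit → Bool) => Sum.elim y
        (Sum.elim (fun _ : Unit => (y (.inl i₀) || y (.inr ())))
          (fun _ : Unit => (y (.inl i₀) && y (.inr ()))))) 2 := by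
      have ho := (DMF.disj (DMF.var (Sum.inl i₀)) (DMF.var (Sum.inr ()))).cktSize
        (J := ι ⊕ Unit)
      have ha := (DMF.conj (DMF.var (Sum.inl i₀)) (DMF.var (Sum.inr ()))).cktSize
        (J := ι ⊕ Unit)
      have h := (CktSize.id deMorganBasis).pair (ho.pair ha)
      exact (h.of_le (by simp [DMF.size])).congr fun y k => by
        rcases k with j | (u | u) <;> simp [DMF.eval]
    have h3 := h1.comp h2
    have h4 : CktSize deMorganBasis (wiresFn ([] : List (Gate ι))) 3 :=
      ((h3.outMap (baseRoute ι)).of_le le_rfl).congr fun x w => by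
        rcases w with (i | m) | (_ | _) <;> simp [wiresFn, baseRoute]
    simpa using h4
  | append_singleton gs g ih =>
    intro hB
    have hgs : ∀ g' ∈ gs, g'.fn ∈ B2 := fun g' hg' => hB g' (List.mem_append_left _ hg')
    have hg : g.arity ≤ 2 := arity_le_two_of_mem_B2 (hB g (by simp))
    have ih' := ih hgs
    -- the multiplexer block for `g`, reading the old wires and the constant coordinates
    set φ : DMF ((ι ⊕ ℕ) ⊕ Bool) :=
      DMF.mux (.inl (g.args₂ (.inl i₀) 0)) (.inl (g.args₂ (.inl i₀) 1)) .inr (g.table hg) with hφ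
    have hblk := φ.cktSize
    rw [hφ, DMF.size_mux, ← hφ] at hblk
    have hstep := ih'.comp ((CktSize.id deMorganBasis).pair hblk)
    -- route: the new gate wire `inr |gs|` to the block output, everything else unchanged
    have hsize : 12 * gs.length + 3 + (0 + 12) ≤ 12 * (gs ++ [g]).length + 3 := by
      simp [List.length_append]; omega
    refine ((hstep.outMap (stepRoute ι gs.length)).of_le hsize).congr fun x w => ?_
    have hv : φ.eval (wiresFn gs x) = g.op fun a => wireOf x (vals gs x) (g.args a) := by
      rw [hφ, DMF.eval_mux _ _ _ _ _ (fun v => rfl)]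
      exact g.table_args₂ hg (.inl i₀) (wireOf x (vals gs x))
    rcases w with (i | m) | v
    · simp [wiresFn, stepRoute]
    · by_cases hm : m = gs.length
      · subst hm
        simp only [stepRoute, if_true, Sum.elim_inr]
        rw [hv]
        simp only [wiresFn, Sum.elim_inl, wireOf_inr, vals_append_singleton]
        rw [List.getD_eq_getElem?_getD, List.getElem?_append_right (by simp)]
        simp
      · simp only [stepRoute, if_neg hm, Sum.elim_inl, wiresFn, wireOf_inr, vals_append_singleton]
        rw [List.getD_eq_getElem?_getD, List.getD_eq_getElem?_getD]
        rcases Nat.lt_or_gt_of_ne hm with hlt | hgt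
        · rw [List.getElem?_append_left (by simpa using hlt)]
        · rw [List.getElem?_append_right (by simp; omega),
            List.getElem?_eq_none (by simp; omega), List.getElem?_eq_none (by simp; omega)]
    · simp [wiresFn, stepRoute]

/-! ### The simulation theorems -/

/-- **`B₂`-programs are simulated by `{∧₂, ∨₂, ¬}`-programs with constant slowdown**: a
multi-output map with a `B₂`-program of `s` gates (on a set of variables containing `i₀`) has a
De Morgan program with at most `12 s + 3` gates (Jukna 2012, §1.2; Vollmer 1999, §1.2).
[cite: Jukna2012, §1.2] -/
theorem CktSize.deMorgan_of_B2 {f : (ι → Bool) → κ → Bool} {s : ℕ} (h : CktSize B2 f s)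
    (i₀ : ι) : CktSize deMorganBasis f (12 * s + 3) := by
  obtain ⟨gs, out, hl, hR⟩ := h
  have hw := cktSize_wiresFn i₀ gs hR.isOver
  refine ((hw.outMap fun k => Sum.inl (out k)).of_le (by omega)).congr fun x k => ?_
  exact hR.eval x k

/-- **Single-output form**: a `B₂`-circuit of size `s` computing `f` (on variables containing
`i₀`) yields a `{∧₂, ∨₂, ¬}`-circuit of size `≤ 12 s + 3` computing `f` (Jukna 2012, §1.2).
[cite: Jukna2012, §1.2] -/
theorem Circuit.exists_deMorgan_of_B2 (C : Circuit ι) (hC : C.IsOver B2) (i₀ : ι)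
    {f : (ι → Bool) → Bool} (hf : C.Computes f) :
    ∃ C' : Circuit ι, C'.IsOver deMorganBasis ∧ C'.Computes f ∧ C'.size ≤ 12 * C.size + 3 := by
  -- the circuit realizes its own function with `C.size` gates (cf. `Circuit.cktSize_eval`)
  have h0 : CktSize B2 (fun x (_ : Unit) => C.eval x) C.size := by
    refine ⟨C.gates, fun _ => C.output, le_rfl,
      ⟨wf_gates C, hC, fun _ m hm => C.wf_output m hm, fun x _ => ?_⟩⟩
    show wireOf x (vals C.gates x) C.output = C.eval x
    unfold Circuit.eval
    cases C.output <;> rfl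
  obtain ⟨C', hB, hs, hev⟩ := (h0.deMorgan_of_B2 i₀).toCircuit
  exact ⟨C', hB, fun x => (hev x).trans (hf x), hs⟩

end Literature.Computability.Complexity
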